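import Literature.AlgebraicGeometry.HodgeTheory.NoTypeIVTimesCMProductSpan
import Literature.AlgebraicGeometry.HodgeTheory.Sl2IsotypicTimesCMDivisorClasses
import Literature.AlgebraicGeometry.HodgeTheory.RealMultiplicationHodgeGroupEqLefschetz
import Literature.AlgebraicGeometry.HodgeTheory.RealSl2Blocks
import Literature.AlgebraicGeometry.HodgeTheory.SimpleAbelianSurfacePowersHodgeClasses
import Literature.AlgebraicGeometry.ComplexMultiplication.FieldOfDegreeTwoDimIsotypic
import Literature.AlgebraicGeometry.Pohlmann1968.SimpleCMAbelianVarietyPowersDivisorGenerated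
import HarnessLib

/-!
# `S × E` is stably nondegenerate for EVERY simple complex abelian surface `S` NOT of CM type and every CM elliptic curve `E` (Moonen–Zarhin 1999 Thm. (3.2)(2) and Thm. 0.1 (4)), PROVED

Family `hodge`, layer `Literature/AlgebraicGeometry/HodgeTheory`. Research context: cell `pub-hodge-ring2`
(HONEST FRAMING: research route conditional on HC_CM; not a corollary; Q11.4-sentence-2 already refuted in
dim ≥ 3), Literature lane (lit seat, generation 52, programme R15 «CM curve × simple surface»). UNCONDITIONAL;
theorems only, no definition, no named fact, nothing here uses or asserts HC_CM; no step towards a summit statement.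

PUBLISHED STATEMENT. Moonen–Zarhin, Math. Ann. 315 (1999), §3 Thm. (3.2)(2): «Suppose `X₁` has no factors of Type 4
and `X₂` is of CM-type [both satisfying condition (D)]. Then `X₁ × X₂` again satisfies (D)» [corpus:
paper:arxiv-math_9901113 p. 6], with §2 (2.2): the four types I(1), I(2), II(1), IV(2,1) of a simple abelian surface,
`B(Sⁿ) = D(Sⁿ)` for all of them (the tree's `AbelianVariety.isStablyNondegenerate_of_isSimple_surface`), and the only
one with a factor of Type 4 is IV(2,1), `End⁰(S)` a quartic CM field — i.e. `S` of CM type.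

RESULTS (UNCONDITIONAL, no binder).
* §1 `hasNoTypeIVFactor_of_isSimple_surface_of_not_isOfCMType` — a simple abelian surface NOT of CM type has no
  factor of Type IV: by `dim_ℚ End⁰(S) ∈ {1, 2, 4}` (`AbelianVariety.finrank_endAlgebra_eq_of_isSimple_surface`),
  `End⁰(S)` is `ℚ`, a REAL quadratic field (`AbelianVariety.isTotallyReal_endField_of_surface`), a quaternion algebra
  over `ℚ` (centre `ℚ`, `AbelianVariety.isQuaternionAlgebra_endAlgebra_of_isSimple`), or a quartic field — and in the
  last case `S` is of CM type (`isOfCMType_of_isField`, degree `4 = 2 dim S`), excluded.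
* §2 **`isStablyNondegenerate_prod_cmCurve_of_isSimple_surface_of_not_isOfCMType`**: `S × E` is stably nondegenerate
  for `S` simple, `dim S = 2`, `S` not of CM type, `E` an elliptic curve of CM type — the tree's R5 product span
  (`hodgeClassesProductSpan_powSucc_powSucc_of_hasNoTypeIVFactor`, `NoTypeIVTimesCMProductSpan`) with Moonen–Zarhin's
  §3 glue (`isStablyNondegenerate_prod_of_forall_productSpan_powSucc`), `B(Sⁿ) = D(Sⁿ)` and `B(Eⁿ) = D(Eⁿ)`
  (`EllipticCurve.isStablyNondegenerate`); all mixed powers, `B = D`, the Hodge conjecture, isogeny invariance; and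
  `S × C` for `C` simple of CM type of dimension `≤ 3` (Pohlmann). Together with the companion file
  `RealSl2BlocksTimesQuaternionProducts` (§4 there: `E × S` for `End⁰(E) = ℚ` and EVERY simple `S`) the threefolds
  `E × S`, `S` simple, have `B = D` on all powers UNLESS `E` and `S` are both of CM type (the CM case is the cell's
  hypothesis HC_CM / Moonen–Zarhin's exceptional case (a); nothing is claimed about it here).

## References
* [MoonenZarhin1999LowDim] B. Moonen, Yu. Zarhin, Math. Ann. 315 (1999) 711–733: §2 (2.2), (1.8) condition (D), §3
  (3.1), Thm. (3.2)(2), Thm. 0.1 (4) [corpus: paper:arxiv-math_9901113 pp. 1, 5–6]. [cite: MoonenZarhin1999LowDim, §3 Thm. (3.2)(2)]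
* [Lombardo2016] D. Lombardo, Algebra Number Theory 10 (2016), Lemma 3.4 (p. 1229). [cite: Lombardo2016, Lemma 3.4 (p. 1229)]
* [MumfordAV1970] D. Mumford, *Abelian Varieties* (1970), §19 Cor. 2 of Thm. 1 (p. 174), §21. [cite: MumfordAV1970, §19 Cor. 2 of Thm. 1 (p. 174)]
* [Shimura1998] G. Shimura, *Abelian Varieties with Complex Multiplication and Modular Functions* (1998), §5.1 Prop. 5. [cite: Shimura1998, §5.1 Proposition 5 (p. 36)]
* [Gordon1999HodgeAVSurvey] B. B. Gordon, App. B of Lewis (1999), Thm. 7.5 (1), Def. 7.6. [cite: Gordon1999HodgeAVSurvey, Thm. 7.5 and Def. 7.6]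
* [Pohlmann1968] H. Pohlmann, Ann. of Math. 88 (1968) 161–180, Thm. 2. [cite: Pohlmann1968, Thm. 2]
* [vanGeemen1994HodgeAV] B. van Geemen, LNM 1594 (1994), §2.4, Lemma 3.7, Thm. 4.3. [cite: vanGeemen1994HodgeAV, Lemma 3.7 and Thm. 4.3]
-/

noncomputable section

open CategoryTheory Module NumberField

namespace Literature.AlgebraicGeometry.HodgeTheory

open Literature.AlgebraicGeometry.Motives (AbelianVariety)
open Literature.AlgebraicGeometry.ComplexMultiplication
open Literature.AlgebraicGeometry.Milne1999
open Literature.Barriers.HodgeConjecture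
open Literature.NumberTheory.Automorphic (IsQuaternionAlgebra)
open Literature.AlgebraicGeometry.Pohlmann1968 (isDivisorGenerated_powSucc_of_isSimple_of_isOfCMType_of_dim_le_three)

/-! ### §1 A simple abelian surface not of CM type has no factor of Type IV -/

section NoTypeIV

variable {S : AbelianVariety ℂ}

/-- **A simple abelian surface with COMMUTATIVE `End⁰(S)` of dimension `4` is of CM type** (`End⁰(S)` is then a
field — Mumford §19 Cor. 2 — of degree `4 = 2 dim S`: Milne's CM type via `isOfCMType_of_isField`).
[cite: MumfordAV1970, §19 Cor. 2 of Thm. 1 (p. 174)] [cite: MoonenZarhin1999LowDim, §2 (2.2)] -/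
theorem isOfCMType_of_isSimple_surface_of_comm_of_finrank_eq_four (hS : S.IsSimple) (hS2 : S.dim = 2)
    (h4 : Module.finrank ℚ S.endAlgebra = 4) (hcomm : ∀ x y : S.endAlgebra, x * y = y * x) : IsOfCMType S := by
  have h0 : 0 < S.dim := by omega
  have hF : IsField S.endAlgebra := AbelianVariety.isField_endAlgebra_of_isSimple_of_comm hS h0 hcomm
  refine isOfCMType_of_isField ⊤ ?_ ?_
  · exact MulEquiv.isField hF
      (Subalgebra.topEquiv : (⊤ : Subalgebra ℚ S.endAlgebra) ≃ₐ[ℚ] S.endAlgebra).toMulEquiv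
  · rw [(Subalgebra.topEquiv : (⊤ : Subalgebra ℚ S.endAlgebra) ≃ₐ[ℚ] S.endAlgebra).toLinearEquiv.finrank_eq, h4, hS2]

/-- **A simple complex abelian surface NOT of CM type has no factor of Type IV** (Moonen–Zarhin (2.2): of the four
types I(1) `End⁰ = ℚ`, I(2) a real quadratic field, II(1) a quaternion algebra over `ℚ` (centre `ℚ`), IV(2,1) a
quartic CM field, only the last — CM type — has a factor of Type 4). [cite: MoonenZarhin1999LowDim, §2 (2.2) and §1]
[cite: MumfordAV1970, §19 Cor. 2 of Thm. 1 and §21] [cite: Shimura1998, §5.1 Proposition 5 (p. 36)] -/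
theorem hasNoTypeIVFactor_of_isSimple_surface_of_not_isOfCMType (hS : S.IsSimple) (hS2 : S.dim = 2)
    (hcm : ¬ IsOfCMType S) : HasNoTypeIVFactor S := by
  classical
  have h0 : 0 < S.dim := by omega
  haveI : Nontrivial S.endAlgebra := nontrivial_endAlgebra_of_dim_pos h0
  rcases AbelianVariety.finrank_endAlgebra_eq_of_isSimple_surface hS hS2 with h1 | h2 | h4
  · haveI := isTotallyReal_endField_of_finrank_eq_one (isField_endAlgebra_of_finrank_eq_one h1) h1
    exact hasNoTypeIVFactor_of_isTotallyReal S (isField_endAlgebra_of_finrank_eq_one h1)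
  · have hF : IsField S.endAlgebra := AbelianVariety.isField_endAlgebra_of_isSimple_of_finrank_eq_two hS h0 h2
    haveI := AbelianVariety.isTotallyReal_endField_of_surface hS2 h2 hF
    exact hasNoTypeIVFactor_of_isTotallyReal S hF
  · by_cases hcomm : ∀ x y : S.endAlgebra, x * y = y * x
    · exact absurd (isOfCMType_of_isSimple_surface_of_comm_of_finrank_eq_four hS hS2 h4 hcomm) hcm
    · simp only [not_forall] at hcomm
      obtain ⟨x, y, hxy⟩ := hcomm
      haveI : IsQuaternionAlgebra ℚ S.endAlgebra :=
        AbelianVariety.isQuaternionAlgebra_endAlgebra_of_isSimple hS h0 h4 ⟨x, y, hxy⟩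
      exact hasNoTypeIVFactor_of_center_le_bot (Algebra.IsCentral.out (K := ℚ) (D := S.endAlgebra))

end NoTypeIV

/-! ### §2 `S × E`: simple non-CM surface times CM elliptic curve -/

section Rows

variable {S C E : AbelianVariety ℂ}

/-- **Moonen–Zarhin Thm. (3.2)(2) / Thm. 0.1 (4), PROVED: `S × E` is stably nondegenerate for EVERY simple abelian
surface `S` not of CM type and every elliptic curve `E` with complex multiplication** — every power `(S × E)^{N+1}`
has `B = D` (`S` has no factor of Type 4 (§1) and satisfies (D); `E` is of CM type and satisfies (D); the product
span of the tree's R5 and Moonen–Zarhin's §3 glue). Rows «I(1) × CM curve», «I(2) × CM curve», «II(1) × CM curve» of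
the threefold list. UNCONDITIONAL, no binder. [cite: MoonenZarhin1999LowDim, Thm. 0.1 (4), §2 (2.2) and §3 Thm. (3.2)(2)]
[cite: Lombardo2016, Lemma 3.4 (p. 1229)] [cite: vanGeemen1994HodgeAV, Thm. 4.3] -/
theorem isStablyNondegenerate_prod_cmCurve_of_isSimple_surface_of_not_isOfCMType (hS : S.IsSimple)
    (hS2 : S.dim = 2) (hcm : ¬ IsOfCMType S) (hE : E.dim = 1) (hEcm : IsOfCMType E) :
    IsStablyNondegenerate (S.prod E) :=
  isStablyNondegenerate_prod_of_forall_productSpan_powSucc S E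
    (fun N => hodgeClassesProductSpan_powSucc_powSucc_of_hasNoTypeIVFactor
      (hasNoTypeIVFactor_of_isSimple_surface_of_not_isOfCMType hS hS2 hcm) hEcm N N)
    (AbelianVariety.isStablyNondegenerate_of_isSimple_surface S hS hS2) (EllipticCurve.isStablyNondegenerate hE)

/-- **All `S^{M+1} × E^{N+1}` are stably nondegenerate** (`S` simple non-CM surface, `E` CM elliptic curve).
[cite: MoonenZarhin1999LowDim, Thm. 0.1 (4) and §3 Thm. (3.2)(2)] [cite: Gordon1999HodgeAVSurvey, Def. 7.6] -/
theorem isStablyNondegenerate_powSucc_prod_powSucc_cmCurve_of_isSimple_surface_of_not_isOfCMType (hS : S.IsSimple)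
    (hS2 : S.dim = 2) (hcm : ¬ IsOfCMType S) (hE : E.dim = 1) (hEcm : IsOfCMType E) (M N : ℕ) :
    IsStablyNondegenerate ((S.powSucc M).prod (E.powSucc N)) :=
  (isStablyNondegenerate_prod_cmCurve_of_isSimple_surface_of_not_isOfCMType hS hS2 hcm hE hEcm).powSucc_prod_powSucc M N

/-- **`B(S^{M+1} × E^{N+1}) = D(S^{M+1} × E^{N+1})`** (`S` simple non-CM surface, `E` CM elliptic curve).
[cite: MoonenZarhin1999LowDim, Thm. 0.1 (4) and §3 Thm. (3.2)(2)] -/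
theorem isDivisorGenerated_powSucc_prod_powSucc_cmCurve_of_isSimple_surface_of_not_isOfCMType (hS : S.IsSimple)
    (hS2 : S.dim = 2) (hcm : ¬ IsOfCMType S) (hE : E.dim = 1) (hEcm : IsOfCMType E) (M N : ℕ) :
    IsDivisorGenerated ((S.powSucc M).prod (E.powSucc N)) :=
  (isStablyNondegenerate_powSucc_prod_powSucc_cmCurve_of_isSimple_surface_of_not_isOfCMType
    hS hS2 hcm hE hEcm M N).isDivisorGenerated

/-- **The Hodge conjecture for every `S^{M+1} × E^{N+1}`** (`S` simple non-CM surface, `E` CM elliptic curve) —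
UNCONDITIONAL. [cite: MoonenZarhin1999LowDim, Thm. 0.1 (4) and §2 condition (D)] [cite: vanGeemen1994HodgeAV, §2.4] -/
theorem hodgeConjectureFor_powSucc_prod_powSucc_cmCurve_of_isSimple_surface_of_not_isOfCMType (hS : S.IsSimple)
    (hS2 : S.dim = 2) (hcm : ¬ IsOfCMType S) (hE : E.dim = 1) (hEcm : IsOfCMType E) (M N : ℕ) :
    HodgeConjectureFor ((S.powSucc M).prod (E.powSucc N)).dim ((S.powSucc M).prod (E.powSucc N)).X :=
  (isStablyNondegenerate_powSucc_prod_powSucc_cmCurve_of_isSimple_surface_of_not_isOfCMType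
    hS hS2 hcm hE hEcm M N).hodgeConjectureFor

/-- **The Hodge conjecture for `S × E` itself.** [cite: MoonenZarhin1999LowDim, Thm. 0.1 (4)] -/
theorem hodgeConjectureFor_prod_cmCurve_of_isSimple_surface_of_not_isOfCMType (hS : S.IsSimple) (hS2 : S.dim = 2)
    (hcm : ¬ IsOfCMType S) (hE : E.dim = 1) (hEcm : IsOfCMType E) : HodgeConjectureFor (S.prod E).dim (S.prod E).X :=
  (isStablyNondegenerate_prod_cmCurve_of_isSimple_surface_of_not_isOfCMType hS hS2 hcm hE hEcm).hodgeConjectureFor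

/-- **The Hodge conjecture for everything isogenous to a power `(S × E)^{N+1}`** (in particular `E × S` and all
`E^a × S^b` up to isogeny). [cite: vanGeemen1994HodgeAV, Lemma 3.7] [cite: MoonenZarhin1999LowDim, Thm. 0.1 (4)] -/
theorem hodgeConjectureFor_of_isIsogenous_powSucc_prod_cmCurve_of_isSimple_surface_of_not_isOfCMType
    (hS : S.IsSimple) (hS2 : S.dim = 2) (hcm : ¬ IsOfCMType S) (hE : E.dim = 1) (hEcm : IsOfCMType E)
    {X : AbelianVariety ℂ} {N : ℕ} (hX : AbelianVariety.IsIsogenous X ((S.prod E).powSucc N)) :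
    HodgeConjectureFor X.dim X.X :=
  (isStablyNondegenerate_prod_cmCurve_of_isSimple_surface_of_not_isOfCMType
    hS hS2 hcm hE hEcm).hodgeConjectureFor_of_isIsogenous_powSucc hX

/-- **Isogeny invariance of the row**: everything isogenous to `S × E` is stably nondegenerate.
[cite: vanGeemen1994HodgeAV, §3.6 (p. 236)] [cite: MoonenZarhin1999LowDim, Thm. 0.1 (4)] -/
theorem isStablyNondegenerate_of_isIsogenous_prod_cmCurve_of_isSimple_surface_of_not_isOfCMType
    (hS : S.IsSimple) (hS2 : S.dim = 2) (hcm : ¬ IsOfCMType S) (hE : E.dim = 1) (hEcm : IsOfCMType E)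
    {X : AbelianVariety ℂ} (hX : AbelianVariety.IsIsogenous X (S.prod E)) : IsStablyNondegenerate X :=
  (isStablyNondegenerate_prod_cmCurve_of_isSimple_surface_of_not_isOfCMType hS hS2 hcm hE hEcm).of_isIsogenous hX

/-- **`S × C` is stably nondegenerate for `S` a simple non-CM surface and `C` a SIMPLE abelian variety of CM type of
dimension `≤ 3`** (CM elliptic curves, simple CM surfaces and threefolds: `B(Cⁿ) = D(Cⁿ)`, Pohlmann 1968 /
Moonen–Zarhin (5.2)) — e.g. the fourfolds (non-CM simple surface) × (simple CM surface).
[cite: MoonenZarhin1999LowDim, §3 Thm. (3.2)(2) and §5 (5.2)] [cite: Pohlmann1968, Thm. 2] -/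
theorem isStablyNondegenerate_prod_of_isSimple_surface_of_not_isOfCMType_of_isSimple_of_isOfCMType_of_dim_le_three
    (hS : S.IsSimple) (hS2 : S.dim = 2) (hcm : ¬ IsOfCMType S) (hs : C.IsSimple) (h0 : 0 < C.dim) (h3 : C.dim ≤ 3)
    (hCcm : IsOfCMType C) : IsStablyNondegenerate (S.prod C) :=
  isStablyNondegenerate_prod_of_forall_productSpan_powSucc S C
    (fun N => hodgeClassesProductSpan_powSucc_powSucc_of_hasNoTypeIVFactor
      (hasNoTypeIVFactor_of_isSimple_surface_of_not_isOfCMType hS hS2 hcm) hCcm N N)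
    (AbelianVariety.isStablyNondegenerate_of_isSimple_surface S hS hS2)
    (fun N => isDivisorGenerated_powSucc_of_isSimple_of_isOfCMType_of_dim_le_three C hs h0 h3 hCcm N)

end Rows

end Literature.AlgebraicGeometry.HodgeTheory
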